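import Summits.CriticalPhenomena.PercolationContinuityZ3.Theorems.PercLowPointHalfSpaceQuantitativeBGNWallDefs
import Summits.CriticalPhenomena.PercolationContinuityZ3.Theorems.PercLowPointHalfSpaceQuantitativeBGNWallTransfer
import Literature.Probability.LatticeModels.ProdBernoulliIndependence
import Mathlib.Analysis.SpecialFunctions.Pow.Real
import HarnessLib

/-!
# `QuantitativeBGN` (stmt-CriticalPhenomena-0913), line `longrange-wall-ghost-bootstrap` — bootstrap, preparations

Helper file for the stub `stub_wallBootstrap` of the skeleton
`Cruxes/QuantitativeBGN/Lines/longrange_wall_ghost_bootstrap.lean` (objects in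
`Theorems/PercLowPointHalfSpaceQuantitativeBGNWallDefs.lean`, namespace `…Theorems.WallGhost`), proved in
`Theorems/PercLowPointHalfSpaceQuantitativeBGNWallBootstrap.lean`. Hutchcroft's bootstrap
(Probab. Theory Relat. Fields 181 (2021), arXiv:2008.11197, Prop. 1.4 / Lemma 4.1 / proof of Thm. 1.1) is run
on the wall `∂H = {x₀ = 0}` of the augmented model `augWall p λ α`; this file supplies its ingredients:

* measurability of `{F_x ≥ n}` at every vertex (`WallBootstrap.measurableSet_footGe`);
* **wall-translation invariance** `P(F_x ≥ n) = P(F_0 ≥ n)` for wall vectors `x`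
  (`WallBootstrap.real_footGe_eq`): the shift `ω ↦ ω + x` maps lattice edges to lattice edges and wall
  pairs to wall pairs of the same length, so it preserves `augProb` (`prodBernoulli_map_image_equiv`), and
  `C_H(x)(ω + x) = C_H(0)(ω) + x` (`shift_mem_openConnIn_iff`);
* the a priori input from subcriticality: `E|C_H(0)| < ∞` gives a.s. finiteness of `C_H(0)` and, by Markov,
  `P(F ≥ m) ≤ E|C_H(0)|/m` (`WallBootstrap.real_footGe_le_div`);
* **the union bound** `P(F ≥ n)² ≤ P(S'_{x,n}) + P(0 ↔_H x)` (Harris' inequality for the increasing events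
  `{F_0 ≥ n}`, `{F_x ≥ n}` under the product measure, translation invariance, inclusion of events;
  `wall_sq_real_footGe_le`, registered);
* the two-point sum over a finite wall set `Λ`: `Σ_{y∈Λ} P(0 ↔_H y) ≤ E[F ∧ |Λ|] = Σ_{i<|Λ|} P(F ≥ i+1)`
  (`WallBootstrap.sum_real_openConnIn_le`, linearity and a pointwise count);
* two elementary inequalities: `Σ_{i<M} (i+1)^{-θ} ≤ M^{1-θ}/(1-θ)` (telescoping Bernoulli) and the weighted
  Cauchy–Schwarz step `Σ P ≤ √(B W)` from `Σ g P² ≤ B`, `Σ 1/g ≤ W`.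

No new definitions.
-/

noncomputable section

namespace Summit.CriticalPhenomena.PercolationContinuityZ3.Theorems

open MeasureTheory Literature.Probability.Percolation Literature.Probability.LatticeModels
open Summit.CriticalPhenomena.PercolationContinuityZ3.Theorems.WallGhost
open scoped ENNReal

namespace WallBootstrap

/-! ### Measurability of the footprint events at every vertex -/

/-- `ω ↦ C_H(x)(ω)` is measurable. [folklore] -/
theorem measurable_clusterH (x : Site 3) :
    Measurable fun ω : BondConfig (Site 3) => clusterH ω x :=
  measurable_set_iff.2 fun v => measurableSet_setOf.1
    (measurableSet_openConnIn_of_countable ({y : Site 3 | 0 ≤ y 0}) x v)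

/-- `ω ↦ F_x(ω)` is measurable. [folklore] -/
theorem measurable_footAt (x : Site 3) : Measurable fun ω : BondConfig (Site 3) => footAt ω x := by
  refine measurable_encard.comp (measurable_set_iff.2 fun v => ?_)
  exact (measurable_set_iff.1 (measurable_clusterH x) v).and measurable_const

/-- `{F_x ≥ n}` is measurable. [folklore] -/
theorem measurableSet_footGe (x : Site 3) (n : ℕ) : MeasurableSet (footGe x n) :=
  measurable_footAt x (MeasurableSet.of_discrete (s := Set.Ici (n : ℕ∞)))

/-! ### Wall translations preserve the augmented model -/

/-- The augmented weights are invariant under translation by a wall vector. [folklore] -/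
theorem augProb_shift (p : unitInterval) (lam α : ℝ) {x : Site 3} (hx : x 0 = 0) (e : Sym2 (Site 3)) :
    augProb p lam α (sym2Equiv (Site.shift x) e) = augProb p lam α e := by
  classical
  have h1 : sym2Equiv (Site.shift x) e ∈ (zdGraph 3).edgeSet ↔ e ∈ (zdGraph 3).edgeSet :=
    sym2Equiv_mem_edgeSet_iff (G := zdGraph 3) (G' := zdGraph 3)
      { toEquiv := Site.shift x, map_rel_iff' := fun {a b} => zdGraph_adj_shift_iff x a b } e
  have h2 : sym2Equiv (Site.shift x) e ∈ wallPairs ↔ e ∈ wallPairs := by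
    induction e using Sym2.ind with
    | h u v => simp [mk_mem_wallPairs, hx]
  have h3 : pairDist (sym2Equiv (Site.shift x) e) = pairDist e := by
    induction e using Sym2.ind with
    | h u v => simp [pairDist_mk]
  unfold augProb augWeight
  simp only [h1, h2, h3]

/-- The `H`-cluster of `x` in the configuration shifted by the wall vector `x` is the shift of the
`H`-cluster of `0`. [folklore] -/
theorem clusterH_shift {x : Site 3} (hx : x 0 = 0) (ω : BondConfig (Site 3)) :
    clusterH (BondConfig.relabel (sym2Equiv (Site.shift x)) ω) x = Site.shift x '' clusterH ω 0 := by
  have hH : ∀ u : Site 3, u + x ∈ ({y : Site 3 | 0 ≤ y 0}) ↔ u ∈ ({y : Site 3 | 0 ≤ y 0}) := fun u => by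
    simp [hx]
  ext v
  rw [Set.mem_image_equiv, mem_clusterH, mem_clusterH, Site.shift_symm_apply]
  have := shift_mem_openConnIn_iff x hH ω 0 (v - x)
  rwa [zero_add, sub_add_cancel] at this

/-- The footprint of `x` in the shifted configuration is the footprint of `0`. [folklore] -/
theorem footAt_shift {x : Site 3} (hx : x 0 = 0) (ω : BondConfig (Site 3)) :
    footAt (BondConfig.relabel (sym2Equiv (Site.shift x)) ω) x = footAt ω 0 := by
  have hW : Site.shift x '' {v : Site 3 | v 0 = 0} = {v | v 0 = 0} := by
    ext v
    rw [Set.mem_image_equiv]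
    simp [hx]
  have hset : clusterH (BondConfig.relabel (sym2Equiv (Site.shift x)) ω) x ∩ {v | v 0 = 0} =
      Site.shift x '' (clusterH ω 0 ∩ {v | v 0 = 0}) := by
    rw [Set.image_inter (Site.shift x).injective, hW, clusterH_shift hx]
  unfold footAt
  rw [hset, (Site.shift x).injective.encard_image]

/-- `{F_x ≥ n}` is the preimage of `{F_0 ≥ n}` under the shift by `x`. [folklore] -/
theorem preimage_footGe_shift {x : Site 3} (hx : x 0 = 0) (n : ℕ) :
    (fun ω : BondConfig (Site 3) => (sym2Equiv (Site.shift x)) '' ω) ⁻¹' footGe x n = footGe 0 n := by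
  ext ω
  rw [Set.mem_preimage, mem_footGe, mem_footGe, ← footAt_shift hx ω]
  rfl

/-- **Wall-translation invariance**: `P(F_x ≥ n) = P(F_0 ≥ n)` under `augWall p λ α` for every wall
vector `x`. [folklore] -/
theorem real_footGe_eq (p : unitInterval) (lam α : ℝ) {x : Site 3} (hx : x 0 = 0) (n : ℕ) :
    (augWall p lam α).real (footGe x n) = (augWall p lam α).real (footGe 0 n) := by
  rw [← preimage_footGe_shift hx n]
  exact (prodBernoulli_real_preimage_image_equiv (augProb p lam α) (sym2Equiv (Site.shift x))
    (fun e => augProb_shift p lam α hx e) (measurableSet_footGe x n)).symm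

/-! ### A priori input from subcriticality: a.s. finiteness and Markov's inequality -/

/-- `ω ↦ |C_H(0)(ω)| ∈ ℝ≥0∞` is measurable. [folklore] -/
theorem measurable_encard_clusterH :
    Measurable fun ω : BondConfig (Site 3) => ((clusterH ω 0).encard : ℝ≥0∞) :=
  (Measurable.of_discrete (f := (fun m : ℕ∞ => (m : ℝ≥0∞)))).comp
    (measurable_encard.comp (measurable_clusterH 0))

/-- Finite mean cluster size forces a.s. finiteness of `C_H(0)`. [folklore] -/
theorem measure_not_finite_eq_zero (p : unitInterval) (lam α : ℝ)
    (hfin : ∫⁻ ω, ((clusterH ω 0).encard : ℝ≥0∞) ∂(augWall p lam α) < ⊤) :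
    augWall p lam α {ω | ¬ (clusterH ω 0).Finite} = 0 := by
  have hae := ae_lt_top measurable_encard_clusterH hfin.ne
  rw [ae_iff] at hae
  have hset : {ω : BondConfig (Site 3) | ¬ (clusterH ω 0).Finite} =
      {ω | ¬ ((clusterH ω 0).encard : ℝ≥0∞) < ⊤} := by
    ext ω
    rw [Set.mem_setOf_eq, Set.mem_setOf_eq, ENat.toENNReal_lt_top, Set.encard_lt_top_iff]
  rw [hset]
  exact hae

/-- **Markov**: `P(F ≥ m) ≤ E|C_H(0)| / m` (`F ≤ |C_H(0)|`). [folklore] -/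
theorem real_footGe_le_div (p : unitInterval) (lam α : ℝ)
    (hfin : ∫⁻ ω, ((clusterH ω 0).encard : ℝ≥0∞) ∂(augWall p lam α) < ⊤) {m : ℕ} (hm : 1 ≤ m) :
    (augWall p lam α).real (footGe 0 m) ≤
      (∫⁻ ω, ((clusterH ω 0).encard : ℝ≥0∞) ∂(augWall p lam α)).toReal / m := by
  set μ := augWall p lam α with hμ
  have hmarkov := mul_meas_ge_le_lintegral (μ := μ) measurable_encard_clusterH (m : ℝ≥0∞)
  have hsub : footGe (0 : Site 3) m ⊆ {ω | (m : ℝ≥0∞) ≤ ((clusterH ω 0).encard : ℝ≥0∞)} := by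
    intro ω hω
    have h1 : (m : ℕ∞) ≤ (clusterH ω 0).encard :=
      (mem_footGe.1 hω).trans (Set.encard_le_encard Set.inter_subset_left)
    have h2 := ENat.toENNReal_le.2 h1
    simpa using h2
  have hle : (m : ℝ≥0∞) * μ (footGe 0 m) ≤ ∫⁻ ω, ((clusterH ω 0).encard : ℝ≥0∞) ∂μ :=
    calc (m : ℝ≥0∞) * μ (footGe 0 m)
        ≤ (m : ℝ≥0∞) * μ {ω | (m : ℝ≥0∞) ≤ ((clusterH ω 0).encard : ℝ≥0∞)} := by gcongr
      _ ≤ _ := hmarkov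
  have hmpos : (0 : ℝ) < m := by exact_mod_cast hm
  rw [le_div_iff₀ hmpos, mul_comm, measureReal_def,
    show (m : ℝ) = ((m : ℝ≥0∞)).toReal by simp, ← ENNReal.toReal_mul]
  exact ENNReal.toReal_mono hfin.ne hle

end WallBootstrap

/-! ### (1) Harris, translation invariance and the union bound (registered helper) -/

open WallBootstrap in
/-- **`P(F ≥ n)² ≤ P(S'_{x,n}) + P(0 ↔_H x)`** for every wall vector `x`, when `C_H(0)` is a.s. finite
under `augWall p λ α`: `P(F_0 ≥ n) P(F_x ≥ n) ≤ P(F_0 ≥ n, F_x ≥ n)` (Harris' inequality for increasing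
events under the product measure), `P(F_x ≥ n) = P(F_0 ≥ n)` (wall-translation invariance), and on
`{F_0 ≥ n, F_x ≥ n}` either `0 ↔_H x`, or `C_H(0)` is infinite (null), or `S'_{x,n}` happens.
[cite: Hutchcroft2021, Lemma 4.1 (proof) and proof of Prop. 1.4] -/
theorem wall_sq_real_footGe_le : ∀ (p : unitInterval) (lam α : ℝ), augWall p lam α {ω | ¬ (clusterH ω 0).Finite} = 0 → ∀ (x : Site 3), x 0 = 0 → ∀ n : ℕ, (augWall p lam α).real (footGe 0 n) ^ 2 ≤ (augWall p lam α).real (wallTwoArm x n) + (augWall p lam α).real (openConnIn {y : Site 3 | 0 ≤ y 0} 0 x) := by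
  intro p lam α hnull x hx n
  set μ := augWall p lam α with hμ
  have hharris : μ.real (footGe 0 n) * μ.real (footGe x n) ≤ μ.real (footGe 0 n ∩ footGe x n) :=
    prodBernoulli_harris _ (isUpperSet_footGe 0 n) (isUpperSet_footGe x n)
      (measurableSet_footGe 0 n) (measurableSet_footGe x n)
  have hsub : footGe 0 n ∩ footGe x n ⊆
      (wallTwoArm x n ∪ openConnIn {y : Site 3 | 0 ≤ y 0} 0 x) ∪ {ω | ¬ (clusterH ω 0).Finite} := by
    rintro ω ⟨h0, hx'⟩
    by_cases hc : ω ∈ openConnIn {y : Site 3 | 0 ≤ y 0} 0 x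
    · exact Or.inl (Or.inr hc)
    by_cases hf : (clusterH ω 0).Finite
    · exact Or.inl (Or.inl ⟨hc, h0, hx', hf⟩)
    · exact Or.inr hf
  have hN : μ.real {ω | ¬ (clusterH ω 0).Finite} = 0 := by
    rw [measureReal_def, hnull, ENNReal.toReal_zero]
  calc μ.real (footGe 0 n) ^ 2 = μ.real (footGe 0 n) * μ.real (footGe x n) := by
        rw [sq, real_footGe_eq p lam α hx n]
    _ ≤ μ.real (footGe 0 n ∩ footGe x n) := hharris
    _ ≤ μ.real ((wallTwoArm x n ∪ openConnIn {y : Site 3 | 0 ≤ y 0} 0 x) ∪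
          {ω | ¬ (clusterH ω 0).Finite}) := measureReal_mono hsub
    _ ≤ μ.real (wallTwoArm x n ∪ openConnIn {y : Site 3 | 0 ≤ y 0} 0 x) +
          μ.real {ω | ¬ (clusterH ω 0).Finite} := measureReal_union_le _ _
    _ = μ.real (wallTwoArm x n ∪ openConnIn {y : Site 3 | 0 ≤ y 0} 0 x) := by rw [hN, add_zero]
    _ ≤ _ := measureReal_union_le _ _

namespace WallBootstrap

/-! ### (2) The two-point sum over a finite wall set: `Σ_{y∈Λ} P(0 ↔_H y) ≤ E[F ∧ |Λ|]` -/

/-- Pointwise: the number of points of a finite wall set `Λ` joined to `0` inside `H` is at most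
`F ∧ |Λ| = Σ_{i<|Λ|} 1{F ≥ i+1}`. [folklore] -/
theorem sum_indicator_le (Λ : Finset (Site 3)) (hΛ : ∀ y ∈ Λ, y 0 = 0) (ω : BondConfig (Site 3)) :
    ∑ y ∈ Λ, (openConnIn {z : Site 3 | 0 ≤ z 0} 0 y).indicator (fun _ => (1 : ℝ)) ω ≤
      ∑ i ∈ Finset.range Λ.card, (footGe 0 (i + 1)).indicator (fun _ => (1 : ℝ)) ω := by
  classical
  simp only [Set.indicator_apply, Finset.sum_boole, mem_footGe]
  set k := (Λ.filter fun y => ω ∈ openConnIn {z : Site 3 | 0 ≤ z 0} 0 y).card with hk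
  have hkM : k ≤ Λ.card := Finset.card_filter_le _ _
  have hkF : (k : ℕ∞) ≤ footAt ω 0 := by
    rw [hk, ← Set.encard_coe_eq_coe_finsetCard]
    exact Set.encard_le_encard fun y hy => by
      obtain ⟨hyΛ, hyK⟩ := Finset.mem_filter.1 (Finset.mem_coe.1 hy)
      exact ⟨hyK, hΛ y hyΛ⟩
  have hsub : Finset.range k ⊆
      (Finset.range Λ.card).filter fun i => ((i + 1 : ℕ) : ℕ∞) ≤ footAt ω 0 := by
    intro i hi
    rw [Finset.mem_range] at hi
    refine Finset.mem_filter.2 ⟨Finset.mem_range.2 (lt_of_lt_of_le hi hkM), le_trans ?_ hkF⟩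
    exact_mod_cast hi
  have := Finset.card_le_card hsub
  rw [Finset.card_range] at this
  exact_mod_cast this

/-- **`Σ_{y∈Λ} P(0 ↔_H y) ≤ Σ_{i<|Λ|} P(F ≥ i+1)`** (`= E[F ∧ |Λ|]`) for a finite wall set `Λ` and any finite
measure (linearity of the integral and the pointwise count). [cite: Hutchcroft2021, Lemma 4.1 (proof)] -/
theorem sum_real_openConnIn_le (μ : Measure (BondConfig (Site 3))) [IsFiniteMeasure μ]
    (Λ : Finset (Site 3)) (hΛ : ∀ y ∈ Λ, y 0 = 0) :
    ∑ y ∈ Λ, μ.real (openConnIn {z : Site 3 | 0 ≤ z 0} 0 y) ≤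
      ∑ i ∈ Finset.range Λ.card, μ.real (footGe 0 (i + 1)) := by
  have hmK : ∀ y, MeasurableSet (openConnIn {z : Site 3 | 0 ≤ z 0} 0 y : Set (BondConfig (Site 3))) :=
    fun y => measurableSet_openConnIn_of_countable _ 0 y
  have hmF : ∀ m, MeasurableSet (footGe (0 : Site 3) m) := measurableSet_footGe 0
  calc ∑ y ∈ Λ, μ.real (openConnIn {z : Site 3 | 0 ≤ z 0} 0 y)
      = ∑ y ∈ Λ, ∫ ω, (openConnIn {z : Site 3 | 0 ≤ z 0} 0 y).indicator (fun _ => (1 : ℝ)) ω ∂μ := by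
        refine Finset.sum_congr rfl fun y _ => ?_
        rw [integral_indicator_const _ (hmK y), smul_eq_mul, mul_one]
    _ = ∫ ω, ∑ y ∈ Λ, (openConnIn {z : Site 3 | 0 ≤ z 0} 0 y).indicator (fun _ => (1 : ℝ)) ω ∂μ :=
        (integral_finsetSum _ fun y _ => (integrable_const (1 : ℝ)).indicator (hmK y)).symm
    _ ≤ ∫ ω, ∑ i ∈ Finset.range Λ.card, (footGe 0 (i + 1)).indicator (fun _ => (1 : ℝ)) ω ∂μ :=
        integral_mono (integrable_finsetSum _ fun y _ => (integrable_const (1 : ℝ)).indicator (hmK y))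
          (integrable_finsetSum _ fun i _ => (integrable_const (1 : ℝ)).indicator (hmF (i + 1)))
          fun ω => sum_indicator_le Λ hΛ ω
    _ = ∑ i ∈ Finset.range Λ.card, μ.real (footGe 0 (i + 1)) := by
        rw [integral_finsetSum _ fun i _ => (integrable_const (1 : ℝ)).indicator (hmF (i + 1))]
        refine Finset.sum_congr rfl fun i _ => ?_
        rw [integral_indicator_const _ (hmF (i + 1)), smul_eq_mul, mul_one]

/-! ### Elementary inequalities -/

/-- Bernoulli: `(1-θ) (m+1)^{-θ} ≤ (m+1)^{1-θ} - m^{1-θ}` for `0 ≤ θ ≤ 1`. [folklore] -/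
theorem rpow_step {θ : ℝ} (hθ0 : 0 ≤ θ) (hθ1 : θ ≤ 1) (m : ℕ) :
    (1 - θ) * ((m : ℝ) + 1) ^ (-θ) ≤ ((m : ℝ) + 1) ^ (1 - θ) - (m : ℝ) ^ (1 - θ) := by
  set t : ℝ := (m : ℝ) + 1 with ht
  have htpos : 0 < t := by positivity
  have ht1 : 1 ≤ t := by rw [ht]; linarith [(Nat.cast_nonneg m : (0 : ℝ) ≤ m)]
  have hs : -1 ≤ -1 / t := by
    rw [neg_div, neg_le_neg_iff, div_le_one htpos]; exact ht1
  have hs0 : 0 ≤ 1 + -1 / t := by linarith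
  have hm : (m : ℝ) = t * (1 + -1 / t) := by
    field_simp
    rw [ht]; ring
  have hb : (1 + -1 / t) ^ (1 - θ) ≤ 1 + (1 - θ) * (-1 / t) :=
    rpow_one_add_le_one_add_mul_self hs (by linarith) (by linarith)
  have h1 : (m : ℝ) ^ (1 - θ) = t ^ (1 - θ) * (1 + -1 / t) ^ (1 - θ) := by
    rw [hm, Real.mul_rpow htpos.le hs0]
  have h2 : t ^ (1 - θ) * (1 / t) = t ^ (-θ) := by
    rw [one_div, ← Real.rpow_neg_one, ← Real.rpow_add htpos]
    ring_nf
  calc (1 - θ) * t ^ (-θ) = t ^ (1 - θ) - t ^ (1 - θ) * (1 + (1 - θ) * (-1 / t)) := by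
        rw [← h2]; ring
    _ ≤ t ^ (1 - θ) - t ^ (1 - θ) * (1 + -1 / t) ^ (1 - θ) :=
        sub_le_sub_left (mul_le_mul_of_nonneg_left hb (Real.rpow_nonneg htpos.le _)) _
    _ = t ^ (1 - θ) - (m : ℝ) ^ (1 - θ) := by rw [h1]

/-- `Σ_{i<M} (i+1)^{-θ} ≤ M^{1-θ}/(1-θ)` for `0 ≤ θ < 1` (telescoping `rpow_step`). [folklore] -/
theorem sum_rpow_neg_le {θ : ℝ} (hθ0 : 0 ≤ θ) (hθ1 : θ < 1) (M : ℕ) :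
    ∑ i ∈ Finset.range M, ((i : ℝ) + 1) ^ (-θ) ≤ (M : ℝ) ^ (1 - θ) / (1 - θ) := by
  have h1θ : 0 < 1 - θ := by linarith
  rw [le_div_iff₀ h1θ, Finset.sum_mul]
  induction M with
  | zero => simp [Real.zero_rpow h1θ.ne']
  | succ M ih =>
    rw [Finset.sum_range_succ]
    have := rpow_step hθ0 hθ1.le M
    push_cast
    linarith

/-- **Cauchy–Schwarz with weights**: `Σ P ≤ √(B W)` whenever `Σ g P² ≤ B`, `Σ 1/g ≤ W`, `g > 0`, `P ≥ 0`
(`Σ P = Σ (√g P)(1/√g)`). [folklore] -/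
theorem sum_le_sqrt_of_weights {ι : Type*} (s : Finset ι) (g P : ι → ℝ) (hg : ∀ x ∈ s, 0 < g x)
    (hP : ∀ x ∈ s, 0 ≤ P x) {B W : ℝ} (hB : ∑ x ∈ s, g x * P x ^ 2 ≤ B)
    (hW : ∑ x ∈ s, 1 / g x ≤ W) : ∑ x ∈ s, P x ≤ Real.sqrt (B * W) := by
  have hCS := Finset.sum_mul_sq_le_sq_mul_sq s (fun x => Real.sqrt (g x) * P x) (fun x => 1 / Real.sqrt (g x))
  have hprod : ∀ x ∈ s, Real.sqrt (g x) * P x * (1 / Real.sqrt (g x)) = P x := by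
    intro x hx
    have := Real.sqrt_pos.2 (hg x hx)
    field_simp
  rw [Finset.sum_congr rfl hprod] at hCS
  have h1 : ∑ x ∈ s, (Real.sqrt (g x) * P x) ^ 2 ≤ B := by
    calc ∑ x ∈ s, (Real.sqrt (g x) * P x) ^ 2 = ∑ x ∈ s, g x * P x ^ 2 :=
          Finset.sum_congr rfl fun x hx => by rw [mul_pow, Real.sq_sqrt (hg x hx).le]
      _ ≤ B := hB
  have h2 : ∑ x ∈ s, (1 / Real.sqrt (g x)) ^ 2 ≤ W := by
    calc ∑ x ∈ s, (1 / Real.sqrt (g x)) ^ 2 = ∑ x ∈ s, 1 / g x :=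
          Finset.sum_congr rfl fun x hx => by rw [div_pow, one_pow, Real.sq_sqrt (hg x hx).le]
      _ ≤ W := hW
  have hB0 : 0 ≤ B := le_trans (Finset.sum_nonneg fun x hx => mul_nonneg (hg x hx).le (sq_nonneg _)) hB
  have hS0 : 0 ≤ ∑ x ∈ s, P x := Finset.sum_nonneg hP
  have hsq : (∑ x ∈ s, P x) ^ 2 ≤ B * W :=
    hCS.trans (mul_le_mul h1 h2 (Finset.sum_nonneg fun _ _ => sq_nonneg _) hB0)
  rw [← Real.sqrt_sq hS0]
  exact Real.sqrt_le_sqrt hsq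

end WallBootstrap

end Summit.CriticalPhenomena.PercolationContinuityZ3.Theorems

end
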